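import HarnessLib
import Summits.CriticalPhenomena.Ising3DConformalLimit.Theorems.HarmonicMomentsIsotropyTwoPointAsymptoticIsotropyPairPointwiseContinuity
import Summits.CriticalPhenomena.Ising3DConformalLimit.Theorems.HarmonicMomentsIsotropyTwoPointAsymptoticIsotropyPairPointwiseSymmetry
import Literature.Probability.LatticeModels.CriticalTwoPointLower

/-!
# Vague asymptotic isotropy of the critical `ℤ³` two-point function, XIX:
# POINTWISE convergence of the rescaled pair correlator is LOCALLY UNIFORM (kernel form)
(route HarmonicMomentsIsotropy, support item stmt-CriticalPhenomena-6036 `TwoPointAsymptoticIsotropy`;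
fifth file of the pointwise line: item stmt-CriticalPhenomena-6153 `PointwiseLimit` ⇒ item 6036)

A Pólya–Dini upgrade. `tendstoLocallyUniformlyOn_of_antitone` (abstract): functions `g_δ` on the
closed positive orthant of `ℝ³` that are non-increasing for the coordinatewise order and converge
pointwise, off the origin, to a function `K` continuous there, converge locally uniformly off the
origin — at `u⁰` squeeze `g_δ(q) ≤ g_δ(u) ≤ g_δ(p)` between the corners `p = (u⁰ - r)₊`, `q = u⁰ + r`.
For the kernel of a pointwise pair scaling limit of the critical `ℤ³` Ising two-point function this
applies on each of the eight closed orthants (`kernel_tendstoLocallyUniformlyOn_pt`): at mesh `δ` the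
rescaled two-point function `y ↦ ρ(δ)²⟨σ₀σ_{[y/δ]}⟩_{β_c}` is non-increasing in each `|y_i|` on every
closed orthant (Messager–Miracle-Solé, `criticalTwoPoint_antitone_abs`, with the sign symmetry of the
lattice two-point function for the negative coordinates), the limit kernel is sign-symmetric (file XVI)
and continuous on the positive orthant (file XVIII), hence on `ℝ³ ∖ {0}` (`kernel_continuousOn_pt`);
the eight orthant statements are assembled on compact subsets of `ℝ³ ∖ {0}`. The pair form (locally
uniform convergence on non-coincident PAIRS) follows in file XX.

References: G. Pólya, G. Szegő, *Problems and Theorems in Analysis I* (1972), Pt. II Problem 127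
(Dini–Pólya); A. Messager, S. Miracle-Solé, J. Stat. Phys. 17 (1977) 245–262 [MessagerMiracleSoleJSP1977].
No definitions are introduced.
-/

noncomputable section

namespace Summit.CriticalPhenomena.Ising3DConformalLimit.HarmonicMomentsIsotropyTwoPoint

open Literature.Probability.LatticeModels Literature.MathematicalPhysics.QuantumFieldTheory Filter Set
open scoped Topology
open Summit.CriticalPhenomena.Ising3DConformalLimit.HyperoctahedralRPTwoPoint
open Summit.CriticalPhenomena.Ising3DConformalLimit.RotationUpgradeFromTwoPointNegative (abs_apply_le_norm)

/-! ### The abstract Pólya–Dini upgrade on the positive orthant -/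

/-- **Pólya–Dini on the positive orthant.** Let `g_δ : ℝ³ → ℝ` be, eventually along `l`, non-increasing
for the coordinatewise order on the closed positive orthant, and converge pointwise on
`Q = {u ≥ 0, u ≠ 0}` to a function `K` continuous on `Q`. Then `g_δ → K` locally uniformly on `Q`.
[folklore] -/
theorem tendstoLocallyUniformlyOn_of_antitone {g : ℝ → EuclideanSpace ℝ (Fin 3) → ℝ}
    {K : EuclideanSpace ℝ (Fin 3) → ℝ} {l : Filter ℝ}
    (hmono : ∀ᶠ δ in l, ∀ p u : EuclideanSpace ℝ (Fin 3), (∀ i, 0 ≤ p i) → (∀ i, p i ≤ u i) →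
      g δ u ≤ g δ p)
    (hK : ContinuousOn K {u | (∀ i, 0 ≤ u i) ∧ u ≠ 0})
    (hpt : ∀ u : EuclideanSpace ℝ (Fin 3), (∀ i, 0 ≤ u i) → u ≠ 0 → Tendsto (fun δ => g δ u) l (𝓝 (K u))) :
    TendstoLocallyUniformlyOn g K l {u | (∀ i, 0 ≤ u i) ∧ u ≠ 0} := by
  rw [Metric.tendstoLocallyUniformlyOn_iff]
  rintro ε hε u₀ ⟨hu₀, hu₀0⟩
  have hε4 : 0 < ε / 4 := by positivity
  -- continuity of `K` at `u₀` within `Q`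
  obtain ⟨r₁, hr₁, hKr₁⟩ := Metric.continuousWithinAt_iff.1 (hK u₀ ⟨hu₀, hu₀0⟩) (ε / 4) hε4
  -- a positive coordinate
  obtain ⟨istar, -, histar⟩ := Finset.exists_max_image Finset.univ (fun i => u₀ i) Finset.univ_nonempty
  have hmmax : ∀ i, u₀ i ≤ u₀ istar := fun i => histar i (Finset.mem_univ i)
  have hmpos : 0 < u₀ istar := by
    by_contra h
    apply hu₀0
    ext i
    have h1 := hmmax i
    have h2 := hu₀ i
    simp only [PiLp.zero_apply]
    linarith
  set r := min (r₁ / 4) (u₀ istar / 2) with hr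
  have hrpos : 0 < r := lt_min (by linarith) (by linarith)
  have hrr₁ : 2 * r < r₁ := by have := min_le_left (r₁ / 4) (u₀ istar / 2); rw [hr]; linarith
  have hrm : r ≤ u₀ istar / 2 := min_le_right _ _
  -- the corners
  set p : EuclideanSpace ℝ (Fin 3) := WithLp.toLp 2 fun i => max (u₀ i - r) 0 with hp
  set q : EuclideanSpace ℝ (Fin 3) := WithLp.toLp 2 fun i => u₀ i + r with hq
  have hpi : ∀ i, p i = max (u₀ i - r) 0 := fun i => rfl
  have hqi : ∀ i, q i = u₀ i + r := fun i => rfl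
  have hpnn : ∀ i, 0 ≤ p i := fun i => by rw [hpi]; exact le_max_right _ _
  have hqnn : ∀ i, 0 ≤ q i := fun i => by rw [hqi]; linarith [hu₀ i]
  have hp0 : p ≠ 0 := by
    intro h
    have := congrArg (fun w : EuclideanSpace ℝ (Fin 3) => w istar) h
    simp only [hpi, PiLp.zero_apply] at this
    have : u₀ istar - r ≤ 0 := by rw [← this]; exact le_max_left _ _
    linarith
  have hq0 : q ≠ 0 := by
    intro h
    have := congrArg (fun w : EuclideanSpace ℝ (Fin 3) => w istar) h
    simp only [hqi, PiLp.zero_apply] at this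
    linarith
  -- sup-norm control: `‖v‖ ≤ 2 ‖v.ofLp‖`
  have hnorm : ∀ v : EuclideanSpace ℝ (Fin 3), (∀ i, |v i| ≤ r) → ‖v‖ < r₁ := by
    intro v hv
    have h1 : ‖v.ofLp‖ ≤ r := (pi_norm_le_iff_of_nonneg hrpos.le).2 fun i => by
      rw [Real.norm_eq_abs]; exact hv i
    have h2 := norm_le_two_mul_norm_ofLp v
    linarith
  have hpd : dist p u₀ < r₁ := by
    rw [dist_eq_norm]
    refine hnorm _ fun i => ?_
    rw [PiLp.sub_apply, hpi, abs_le]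
    constructor
    · linarith [le_max_left (u₀ i - r) 0]
    · have : max (u₀ i - r) 0 ≤ u₀ i := max_le (by linarith) (hu₀ i)
      linarith
  have hqd : dist q u₀ < r₁ := by
    rw [dist_eq_norm]
    refine hnorm _ fun i => ?_
    rw [PiLp.sub_apply, hqi, show u₀ i + r - u₀ i = r by ring, abs_of_pos hrpos]
  have hKp := hKr₁ ⟨hpnn, hp0⟩ hpd
  have hKq := hKr₁ ⟨hqnn, hq0⟩ hqd
  -- the neighbourhood and the eventuality
  refine ⟨{u | (∀ i, 0 ≤ u i) ∧ u ≠ 0} ∩ Metric.ball u₀ r,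
    inter_mem_nhdsWithin _ (Metric.ball_mem_nhds _ hrpos), ?_⟩
  have hevp := Metric.tendsto_nhds.1 (hpt p hpnn hp0) (ε / 4) hε4
  have hevq := Metric.tendsto_nhds.1 (hpt q hqnn hq0) (ε / 4) hε4
  filter_upwards [hmono, hevp, hevq] with δ hmonoδ hpδ hqδ
  rintro y ⟨⟨hynn, hy0⟩, hy⟩
  rw [Metric.mem_ball] at hy
  have hcoord : ∀ i, |y i - u₀ i| < r := fun i => by
    have h := hy
    rw [dist_eq_norm] at h
    calc |y i - u₀ i| = |(y - u₀) i| := by simp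
      _ ≤ ‖y - u₀‖ := abs_apply_le_norm _ _
      _ < r := h
  have hpy : ∀ i, p i ≤ y i := fun i => by
    rw [hpi]
    refine max_le ?_ (hynn i)
    have := hcoord i; rw [abs_lt] at this; linarith
  have hyq : ∀ i, y i ≤ q i := fun i => by
    rw [hqi]
    have := hcoord i; rw [abs_lt] at this; linarith
  have h1 : g δ y ≤ g δ p := hmonoδ p y hpnn hpy
  have h2 : g δ q ≤ g δ y := hmonoδ y q hynn hyq
  have hKy := hKr₁ ⟨hynn, hy0⟩ (hy.trans (by linarith))
  rw [Real.dist_eq, abs_lt] at hpδ hqδ hKp hKq hKy ⊢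
  constructor <;> linarith [hpδ.1, hpδ.2, hqδ.1, hqδ.2, hKp.1, hKp.2, hKq.1, hKq.2, hKy.1, hKy.2]

/-! ### Lattice: the critical two-point function is non-increasing in each `|x_i|` -/

/-- **`⟨σ₀σ_x⟩_{β_c}` is non-increasing in each `|x_i|`**: if `y` agrees with `x` off `i` and either
`0 ≤ x_i ≤ y_i` or `y_i ≤ x_i ≤ 0`, then `⟨σ₀σ_y⟩ ≤ ⟨σ₀σ_x⟩` (MMS for `x_i ≥ 0`, and the sign symmetry `twoPointPlus_reflection_invariant_holds`).
[cite: MessagerMiracleSoleJSP1977, main theorem (monotonicity of ⟨σ₀σ_x⟩ under reflections)] -/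
theorem criticalTwoPoint_antitone_abs {x y : Site 3} (i : Fin 3) (hrest : ∀ l, l ≠ i → y l = x l)
    (h : (0 ≤ x i ∧ x i ≤ y i) ∨ (y i ≤ x i ∧ x i ≤ 0)) :
    criticalTwoPoint 3 y ≤ criticalTwoPoint 3 x := by
  rcases h with ⟨hx, hxy⟩ | ⟨hyx, hx⟩
  · exact criticalTwoPoint_le_of_coord_le i hx hxy hrest
  · have hxr : criticalTwoPoint 3 (Function.update x i (-x i)) = criticalTwoPoint 3 x :=
      twoPointPlus_reflection_invariant_holds (criticalBeta_nonneg 3) i x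
    have hyr : criticalTwoPoint 3 (Function.update y i (-y i)) = criticalTwoPoint 3 y :=
      twoPointPlus_reflection_invariant_holds (criticalBeta_nonneg 3) i y
    rw [← hxr, ← hyr]
    refine criticalTwoPoint_le_of_coord_le i ?_ ?_ ?_
    · simp; omega
    · simp; omega
    · intro l hl
      simp [Function.update_of_ne hl, hrest l hl]

/-- The rescaled two-point function at mesh `δ > 0` is non-increasing in each `|y_i|` within a closed
orthant: for a sign vector `s` and `0 ≤ p ≤ u` coordinatewise,
`⟨σ₀σ_{[s⊙u/δ]}⟩ ≤ ⟨σ₀σ_{[s⊙p/δ]}⟩` (`(s⊙u)_i = s_i u_i`). [cite: MessagerMiracleSoleJSP1977, main theorem (monotonicity of ⟨σ₀σ_x⟩ under reflections)] -/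
theorem criticalTwoPoint_latticeApprox_signMul_antitone (s : Fin 3 → ℤˣ) {δ : ℝ} (hδ : 0 < δ)
    {p u : EuclideanSpace ℝ (Fin 3)} (hp : ∀ i, 0 ≤ p i) (hpu : ∀ i, p i ≤ u i) :
    criticalTwoPoint 3 (latticeApprox δ (WithLp.toLp 2 fun i => ((s i : ℤ) : ℝ) * u i)) ≤
      criticalTwoPoint 3 (latticeApprox δ (WithLp.toLp 2 fun i => ((s i : ℤ) : ℝ) * p i)) := by
  -- lattice points and the chain through mixed points
  set xp : Site 3 := latticeApprox δ (WithLp.toLp 2 fun i => ((s i : ℤ) : ℝ) * p i) with hxp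
  set xu : Site 3 := latticeApprox δ (WithLp.toLp 2 fun i => ((s i : ℤ) : ℝ) * u i) with hxu
  have hxpi : ∀ i, xp i = ⌊(s i : ℤ) * p i / δ⌋ := fun i => rfl
  have hxui : ∀ i, xu i = ⌊(s i : ℤ) * u i / δ⌋ := fun i => rfl
  -- one coordinate comparison
  have hstep : ∀ i, (0 ≤ xp i ∧ xp i ≤ xu i) ∨ (xu i ≤ xp i ∧ xp i ≤ 0) := by
    intro i
    rw [hxpi, hxui]
    rcases Int.units_eq_one_or (s i) with h1 | h1 <;> rw [h1]
    · left
      simp only [Units.val_one, Int.cast_one, one_mul]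
      exact ⟨Int.floor_nonneg.2 (div_nonneg (hp i) hδ.le),
        Int.floor_le_floor (div_le_div_of_nonneg_right (hpu i) hδ.le)⟩
    · right
      simp only [Units.val_neg, Units.val_one, Int.cast_neg, Int.cast_one, neg_mul, one_mul]
      refine ⟨Int.floor_le_floor (div_le_div_of_nonneg_right (by linarith [hpu i]) hδ.le), ?_⟩
      exact Int.floor_nonpos (div_nonpos_iff.2 (Or.inr ⟨by linarith [hp i], hδ.le⟩))
  -- mixed points `m k`: coordinates `< k` from `xu`, the rest from `xp`
  set m1 : Site 3 := Function.update xp 0 (xu 0) with hm1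
  set m2 : Site 3 := Function.update m1 1 (xu 1) with hm2
  have hxu_eq : xu = Function.update m2 2 (xu 2) := by
    funext l
    fin_cases l <;> simp [hm2, hm1]
  have h1 : criticalTwoPoint 3 m1 ≤ criticalTwoPoint 3 xp := by
    refine criticalTwoPoint_antitone_abs 0 (fun l hl => by simp [hm1, Function.update_of_ne hl]) ?_
    simp only [hm1, Function.update_self]
    exact hstep 0
  have h2 : criticalTwoPoint 3 m2 ≤ criticalTwoPoint 3 m1 := by
    refine criticalTwoPoint_antitone_abs 1 (fun l hl => by simp [hm2, Function.update_of_ne hl]) ?_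
    simp only [hm2, Function.update_self]
    have : m1 1 = xp 1 := by simp [hm1]
    rw [this]
    exact hstep 1
  have h3 : criticalTwoPoint 3 xu ≤ criticalTwoPoint 3 m2 := by
    rw [hxu_eq]
    refine criticalTwoPoint_antitone_abs 2 (fun l hl => by simp [Function.update_of_ne hl]) ?_
    simp only [Function.update_self]
    have : m2 2 = xp 2 := by simp [hm2, hm1]
    rw [this]
    exact hstep 2
  exact h3.trans (h2.trans h1)

/-! ### The kernel: continuity on `ℝ³ ∖ {0}` and locally uniform convergence -/

variable {ρ : ℝ → ℝ} {S2 : (Fin 2 → EuclideanSpace ℝ (Fin 3)) → ℝ}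

/-- The coordinate sign change `θ_{e_i}` leaves the pointwise kernel invariant. [cite: FriedliVelenik2017, Exercise 3.14, p. 115] -/
theorem kernel_reflection_single_pt
    (hlim : ∀ x ∈ NonCoincident 3 2, Tendsto (fun δ => rescaledCorrelator (criticalCorr 3) ρ 2 δ x)
      (𝓝[>] (0:ℝ)) (𝓝 (S2 x)))
    (i : Fin 3) (y : EuclideanSpace ℝ (Fin 3)) :
    S2 ![0, (ℝ ∙ EuclideanSpace.single i (1:ℝ))ᗮ.reflection y] = S2 ![0, y] := by
  refine kernel_signedPerm_pt hlim (Equiv.refl _) (fun l => if l = i then -1 else 1) _ (fun p l => ?_) y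
  rw [reflection_single_apply]
  by_cases hl : l = i
  · simp [hl]
  · simp [hl]

/-- The kernel is invariant under `u ↦ s ⊙ u` for every sign vector `s`. [cite: FriedliVelenik2017, Exercise 3.14, p. 115] -/
theorem kernel_signMul_pt
    (hlim : ∀ x ∈ NonCoincident 3 2, Tendsto (fun δ => rescaledCorrelator (criticalCorr 3) ρ 2 δ x)
      (𝓝[>] (0:ℝ)) (𝓝 (S2 x)))
    (s : Fin 3 → ℤˣ) (u : EuclideanSpace ℝ (Fin 3)) :
    S2 ![0, WithLp.toLp 2 fun i => ((s i : ℤ) : ℝ) * u i] = S2 ![0, u] := by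
  -- flip the coordinates one at a time
  have hflip : ∀ (i : Fin 3) (v : EuclideanSpace ℝ (Fin 3)),
      S2 ![0, WithLp.toLp 2 (Function.update v.ofLp i (((s i : ℤ) : ℝ) * v i))] = S2 ![0, v] := by
    intro i v
    rcases Int.units_eq_one_or (s i) with h1 | h1
    · have hv : (WithLp.toLp 2 (Function.update v.ofLp i (((s i : ℤ) : ℝ) * v i)) :
          EuclideanSpace ℝ (Fin 3)) = v := by
        ext l
        rw [PiLp.toLp_apply, h1]
        by_cases hl : l = i
        · subst hl; simp
        · simp [hl]
      rw [hv]
    · have hv : (WithLp.toLp 2 (Function.update v.ofLp i (((s i : ℤ) : ℝ) * v i)) :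
          EuclideanSpace ℝ (Fin 3)) = (ℝ ∙ EuclideanSpace.single i (1:ℝ))ᗮ.reflection v := by
        ext l
        rw [PiLp.toLp_apply, h1, reflection_single_apply]
        by_cases hl : l = i
        · subst hl; simp
        · simp [hl]
      rw [hv]
      exact kernel_reflection_single_pt hlim i v
  set v2 : EuclideanSpace ℝ (Fin 3) :=
    WithLp.toLp 2 (Function.update u.ofLp 2 (((s 2 : ℤ) : ℝ) * u 2)) with hv2
  set v1 : EuclideanSpace ℝ (Fin 3) :=
    WithLp.toLp 2 (Function.update v2.ofLp 1 (((s 1 : ℤ) : ℝ) * v2 1)) with hv1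
  have e3 : S2 ![0, v2] = S2 ![0, u] := hflip 2 u
  have e2 : S2 ![0, v1] = S2 ![0, v2] := hflip 1 v2
  have e1 := hflip 0 v1
  have hfin : (WithLp.toLp 2 (Function.update v1.ofLp 0 (((s 0 : ℤ) : ℝ) * v1 0)) :
      EuclideanSpace ℝ (Fin 3)) = WithLp.toLp 2 fun i => ((s i : ℤ) : ℝ) * u i := by
    ext l
    fin_cases l <;> simp [hv1, hv2]
  rw [hfin] at e1
  rw [e1, e2, e3]

/-- **Continuity of the pointwise kernel on `ℝ³ ∖ {0}`** (homogeneity hypothesis as in file XVIII):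
reduce to the closed positive orthant by the sign symmetry `K(s ⊙ y) = K(y)` with `s = sign(y)`.
[cite: MessagerMiracleSoleJSP1977, main theorem (monotonicity of ⟨σ₀σ_x⟩ under reflections)] -/
theorem kernel_continuousOn_pt
    (hlim : ∀ x ∈ NonCoincident 3 2, Tendsto (fun δ => rescaledCorrelator (criticalCorr 3) ρ 2 δ x)
      (𝓝[>] (0:ℝ)) (𝓝 (S2 x)))
    {Δ : ℝ} (hhom : ∀ c : ℝ, 0 < c → ∀ y : EuclideanSpace ℝ (Fin 3), y ≠ 0 →
      S2 ![0, c • y] = c ^ (-(2 * Δ)) * S2 ![0, y]) :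
    ContinuousOn (fun y : EuclideanSpace ℝ (Fin 3) => S2 ![0, y]) {0}ᶜ := by
  -- `K = K ∘ abs` with `abs y = (|y_i|)_i`
  set ab : EuclideanSpace ℝ (Fin 3) → EuclideanSpace ℝ (Fin 3) := fun y => WithLp.toLp 2 fun i => |y i|
    with hab
  have habc : Continuous ab := by
    refine (PiLp.continuous_toLp 2 _).comp ?_
    exact continuous_pi fun i => (continuous_abs.comp ((continuous_apply i).comp (PiLp.continuous_ofLp 2 _)))
  have hKab : ∀ y : EuclideanSpace ℝ (Fin 3), S2 ![0, ab y] = S2 ![0, y] := by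
    intro y
    set s : Fin 3 → ℤˣ := fun i => if y i < 0 then -1 else 1 with hs
    have heq : ab y = WithLp.toLp 2 fun i => ((s i : ℤ) : ℝ) * y i := by
      ext i
      simp only [hab, hs, PiLp.toLp_apply]
      split_ifs with h
      · simp [abs_of_neg h]
      · simp [abs_of_nonneg (not_lt.1 h)]
    rw [heq]
    exact kernel_signMul_pt hlim s y
  have hmaps : MapsTo ab ({0}ᶜ : Set (EuclideanSpace ℝ (Fin 3))) {u | (∀ i, 0 ≤ u i) ∧ u ≠ 0} := by
    intro y hy
    refine ⟨fun i => abs_nonneg _, fun h => hy ?_⟩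
    ext i
    have := congrArg (fun w : EuclideanSpace ℝ (Fin 3) => w i) h
    simp only [hab, PiLp.zero_apply, abs_eq_zero] at this
    simpa using this
  have hcomp := (kernel_continuousOn_orthant_pt hlim hhom).comp habc.continuousOn hmaps
  exact hcomp.congr fun y _ => (hKab y).symm

/-- **Pointwise convergence of the rescaled critical two-point function is locally uniform** (kernel
form): if `ρ(δ)²⟨σ_{[z₀/δ]}σ_{[z₁/δ]}⟩_{β_c}` converges pointwise at every non-coincident pair and the
kernel is homogeneous, then `y ↦ ρ(δ)²⟨σ₀σ_{[y/δ]}⟩_{β_c}` converges to `K(y) = S₂(0,y)` locally uniformly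
on `ℝ³ ∖ {0}`: Pólya–Dini on each closed orthant (MMS monotonicity at finite mesh, continuity of `K`),
assembled on compact sets. [cite: MessagerMiracleSoleJSP1977, main theorem (monotonicity of ⟨σ₀σ_x⟩ under reflections)] -/
theorem kernel_tendstoLocallyUniformlyOn_pt
    (hlim : ∀ x ∈ NonCoincident 3 2, Tendsto (fun δ => rescaledCorrelator (criticalCorr 3) ρ 2 δ x)
      (𝓝[>] (0:ℝ)) (𝓝 (S2 x)))
    {Δ : ℝ} (hhom : ∀ c : ℝ, 0 < c → ∀ y : EuclideanSpace ℝ (Fin 3), y ≠ 0 →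
      S2 ![0, c • y] = c ^ (-(2 * Δ)) * S2 ![0, y]) :
    TendstoLocallyUniformlyOn (fun (δ : ℝ) (y : EuclideanSpace ℝ (Fin 3)) =>
        ρ δ ^ 2 * criticalTwoPoint 3 (latticeApprox δ y))
      (fun y => S2 ![0, y]) (𝓝[>] (0:ℝ)) {0}ᶜ := by
  have hKcont := kernel_continuousOn_pt hlim hhom
  -- the sign maps
  set σ : (Fin 3 → ℤˣ) → EuclideanSpace ℝ (Fin 3) → EuclideanSpace ℝ (Fin 3) :=
    fun s u => WithLp.toLp 2 fun i => ((s i : ℤ) : ℝ) * u i with hσ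
  have hσσ : ∀ s y, σ s (σ s y) = y := by
    intro s y
    ext i
    simp only [hσ]
    rcases Int.units_eq_one_or (s i) with h1 | h1 <;> simp [h1]
  -- Pólya on the positive orthant for each `g^s_δ(u) = f_δ(σ_s u)`
  have hTLUO : ∀ s : Fin 3 → ℤˣ, TendstoLocallyUniformlyOn
      (fun (δ : ℝ) (u : EuclideanSpace ℝ (Fin 3)) => ρ δ ^ 2 * criticalTwoPoint 3 (latticeApprox δ (σ s u)))
      (fun u => S2 ![0, u]) (𝓝[>] (0:ℝ)) {u | (∀ i, 0 ≤ u i) ∧ u ≠ 0} := by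
    intro s
    refine tendstoLocallyUniformlyOn_of_antitone ?_ (hKcont.mono fun u hu => hu.2) fun u hu hu0 => ?_
    · filter_upwards [self_mem_nhdsWithin] with δ hδ p u hp hpu
      exact mul_le_mul_of_nonneg_left (criticalTwoPoint_latticeApprox_signMul_antitone s hδ hp hpu)
        (sq_nonneg _)
    · have hσ0 : σ s u ≠ 0 := fun h => hu0 (by rw [← hσσ s u, h]; ext i; simp [hσ])
      have h := tendsto_kernel_pt hlim hσ0
      have hK : S2 ![0, σ s u] = S2 ![0, u] := kernel_signMul_pt hlim s u
      rw [hK] at h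
      exact h
  -- assemble on compact subsets of `ℝ³ ∖ {0}`
  rw [tendstoLocallyUniformlyOn_iff_forall_isCompact isOpen_compl_singleton]
  intro C hC hCc
  rw [Metric.tendstoUniformlyOn_iff]
  intro ε hε
  have hσc : ∀ s, Continuous (σ s) := fun s => by
    refine (PiLp.continuous_toLp 2 _).comp (continuous_pi fun i => ?_)
    exact continuous_const.mul ((continuous_apply i).comp (PiLp.continuous_ofLp 2 _))
  -- for each sign vector, uniform convergence on the compact piece `σ_s (C ∩ O_s) ⊆ Q`
  have hpiece : ∀ s : Fin 3 → ℤˣ, ∀ᶠ δ in 𝓝[>] (0:ℝ), ∀ y ∈ C, (∀ i, 0 ≤ ((s i : ℤ) : ℝ) * y i) →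
      dist (S2 ![0, y]) (ρ δ ^ 2 * criticalTwoPoint 3 (latticeApprox δ y)) < ε := by
    intro s
    set Cs : Set (EuclideanSpace ℝ (Fin 3)) := σ s '' (C ∩ {y | ∀ i, 0 ≤ ((s i : ℤ) : ℝ) * y i})
      with hCs
    have hCsc : IsCompact Cs := by
      refine (hCc.inter_right ?_).image (hσc s)
      have : {y : EuclideanSpace ℝ (Fin 3) | ∀ i, 0 ≤ ((s i : ℤ) : ℝ) * y i} =
          ⋂ i, {y | 0 ≤ ((s i : ℤ) : ℝ) * y i} := by ext y; simp
      rw [this]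
      exact isClosed_iInter fun i => isClosed_le continuous_const
        (continuous_const.mul ((continuous_apply i).comp (PiLp.continuous_ofLp 2 _)))
    have hCsQ : Cs ⊆ {u | (∀ i, 0 ≤ u i) ∧ u ≠ 0} := by
      rintro _ ⟨y, ⟨hyC, hys⟩, rfl⟩
      refine ⟨fun i => by simpa [hσ] using hys i, fun h => hC hyC ?_⟩
      rw [Set.mem_singleton_iff, ← hσσ s y, h]
      ext i; simp [hσ]
    have hu := (tendstoLocallyUniformlyOn_iff_tendstoUniformlyOn_of_compact hCsc).1
      ((hTLUO s).mono hCsQ)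
    rw [Metric.tendstoUniformlyOn_iff] at hu
    filter_upwards [hu ε hε] with δ hδ y hyC hys
    have h := hδ (σ s y) ⟨y, ⟨hyC, hys⟩, rfl⟩
    have hK : S2 ![0, σ s y] = S2 ![0, y] := kernel_signMul_pt hlim s y
    rwa [hσσ, hK] at h
  have hall := (eventually_all).2 hpiece
  filter_upwards [hall] with δ hδ y hyC
  set s : Fin 3 → ℤˣ := fun i => if y i < 0 then -1 else 1 with hs
  refine hδ s y hyC fun i => ?_
  simp only [hs]
  split_ifs with h
  · simp; linarith
  · simp; linarith

end Summit.CriticalPhenomena.Ising3DConformalLimit.HarmonicMomentsIsotropyTwoPoint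

end
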